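import Summits.QuantumFields.YangMills.Theorems.UnitScaleTiltProp7GaussCompositeSplit
import Summits.QuantumFields.YangMills.Theorems.UnitScaleTiltProp7DirichletOfOffsetFamily
import Summits.QuantumFields.YangMills.Theorems.UnitScaleTiltProp7BondAvgIterCoercivity
import HarnessLib

/-!
# Route `UnitScaleTilt`, crux K1 «MinimiserStabilityRegPr» (stmt-QuantumFields-19200), route-R E′ S3 K-form engine, row (P′) ∕ hXb′ — «DIR-GAUSS ≤ FAM»:
# the displayed row hDirGauss of the HXB′ door (✓ `Prop7GaussCompositeSplit`: the HS Dirichlet energy of the Gauss-comb local models `Ψ^{T_y}(z) = R(g_y·axialT V ȳ_y z)⁻¹ φ(y)` on the blocks'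
# interior bonds) is an AXIAL FAMILY's Dirichlet energy — base = the block CORNER `ȳ_y`, datum `R(g_y⁻¹)φ(y)` — hence AT MOST its canonical (Kg′) family, UNCONDITIONALLY (routeR-w1's
# ✓ `Prop7DirichletOfOffsetFamily.dirichlet_avg_axial_le_canonical` at a one-point average), exactly as hDir ⟸ hKg′-K(fam) (✓p680787): `DIR^{HS}_int(Ψ^T) ≤ N·Σ_y FAM^{corner}_y(R(g_y⁻¹)φ(y))`

Cell `ym3-torus`, width seat `ym3-torus-px15` (gen 3); hXb-inhabitant lane (★ym-ust-19200-p1 g16 WORD 10 (2), p1 g17 WORD 2 «HXB′ DOOR GO»).  THEOREMS ONLY (0 `def`, 0 `sorry`, 0 `instance`);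
`--supports stmt-QuantumFields-19200`, count-neutral.  YM₃ on T³ is a ladder rung (R3), not the Clay problem; nothing here claims a stub, the crux, d = 4 or the mass gap.

WHAT IS PROVED (ns `…Theorems.Prop7DirichletOfGaussComb`; finest torus of any `P`, level `k ≥ 1` with `sitesPerDir 0 = L^k·sitesPerDir k`, `M_N(ℂ)`, `V` unitary-valued).
* §1 geometry from the CORNER: `rel_corner_of_proj_eq` (`rel ȳ z ∈ [0, L^k−1]` on `B(y)`), `rel_corner_unshift_of_proj_eq` (`rel ȳ (z − e_μ) ∈ [−1, L^k−1]`), ★ `hgeo_corner` — the geometry row of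
  ✓ `dirichlet_avg_axial_le_canonical` for `N := (· ∈ B(y))`, `C := ȳ_y`, `R₀ := L^k` (no wrap: `k ≥ 1` ⇒ `N₀ ≥ 6`).
* §2 ★★ `dirichlet_gaussComb_block_le_canonical` — per block: `Σ_{z∈B(y)}Σ_μ(‖D*Ψ^{T_y}‖² + ‖DΨ^{T_y}‖²)_op ≤ FAM^{corner}_y` (the canonical letters of ✓p680787 §1 at `H := Unit`).
* §3 ★★★ `dirGaussHS_int_le_canonical` — THE ROW'S INHABITANT, UNCONDITIONAL PART: the HXB′ door's `DIR^{HS}_int(Ψ^T)` (✓p684863's letter VERBATIM) `≤ N·Σ_y FAM^{corner}_y`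
  (interior offsets ⊂ block, HS ≤ `N`·op², the nonnegative `D*`-terms added).
HONEST SCOPE.  Composition of landed theorems + label arithmetic; the canonical family (sup weights `(2L^k+1)^{|t_μ|−i}`, px9's exact-weight twin swaps in by name) is DISPLAYED — its `≤ C·K + θ·e·ℓ⁻²·M`
booking at `IsCritR2` is the hKg′-K(Gauss-fam) row, numerics∕analysis elsewhere.

References: T. Bałaban, CMP 99 (1985) 389–434 [Balaban1985BackgroundPropagators] ((3.3) p.390, (3.8) p.392); CMP 98 (1985) 17–51 [Balaban1985Averaging] ((9) p.18, (19)–(20) p.21, p.24);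
CMP 102 (1985) 255–275 [Balaban1985UV3] ((27) p.263); CMP 109 (1987) 249–301 [Balaban1987RG1] ((0.1)–(0.3) pp.251–252).
-/

set_option autoImplicit false

noncomputable section

open scoped BigOperators Matrix Matrix.Norms.L2Operator

namespace Summit.QuantumFields.YangMills.Theorems.Prop7DirichletOfGaussComb

open Literature.MathematicalPhysics.QuantumFieldTheory.Balaban1983to89
open Finset
open B7Prop1Explicit (Letter e treeWord hol)
open B7Prop2Explicit (unitaryUnits mem_unitaryUnits)
open B9Eq39Adjoint (R covD covDstar)
open B9TorusCalculus (torusT torusT_symm_apply)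
open B10Eq27TorusAxialLog (holT axialT rel pull transl rel_transl_of_mem transl_sub_e)
open Summit.QuantumFields.YangMills.Theorems.Prop7CovariantCoercivity (sum_norm_sq_le_mul_opNorm_sq)
open Summit.QuantumFields.YangMills.Theorems.Prop7LemmaHCurvedOfRows (bicontr_of_mem_unitary)
open Summit.QuantumFields.YangMills.Theorems.Prop7DirichletOfOffsetFamily (dirichlet_avg_axial_le_canonical)
open Summit.QuantumFields.YangMills.Theorems.Prop7FlatCoercivity (sum_fibre_eq_sum_offsets)
open Summit.QuantumFields.YangMills.Theorems.Prop7FlatHolonomy (sitesPerDir_zero_eq_mul_pow)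
open Summit.QuantumFields.YangMills.Theorems.Prop7GaussCompositeSplit (rel_corner_fibreSite)
open Summit.QuantumFields.YangMills.Theorems.Prop7CovRightInverse (fibreSite_eq_transl)
open Summit.QuantumFields.YangMills.Theorems.Prop7LineAvgSmoothRightInverse (eq_fibreSite_proj)

variable {P : Params} {k : ℕ}

/-! ## §1 Geometry from the block corner -/

section Geometry

/-- `k ≥ 1` ⇒ the finest torus has at least `6` sites per direction (`N₀ = L^k·N_k`, `L ≥ 3`, `N_k ≥ 2`). [cite: Balaban1987RG1, (0.1) p.251] -/
theorem six_le_sitesPerDir (hk : k ≤ P.m + P.K) (hk1 : 1 ≤ k) : 6 ≤ P.sitesPerDir 0 := by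
  rw [sitesPerDir_zero_eq_mul_pow hk]
  have h2 : 2 ≤ P.sitesPerDir k := P.one_lt_sitesPerDir k
  have hL3 : 3 ≤ P.L := by
    obtain ⟨hodd, hgt⟩ := P.hL
    rcases hodd with ⟨t, ht⟩
    omega
  have hLk : 3 ≤ P.L ^ k := by
    calc 3 ≤ P.L := hL3
      _ = P.L ^ 1 := (pow_one _).symm
      _ ≤ P.L ^ k := Nat.pow_le_pow_right P.L_pos hk1
  nlinarith

/-- On the block `B(y)`: `rel ȳ z ν = r_ν ∈ [0, L^k − 1]` where `z = x_r`. [cite: Balaban1987RG1, (0.3) p.252] -/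
theorem rel_corner_of_proj_eq (hk : k ≤ P.m + P.K) (h : P.sitesPerDir 0 = P.L ^ k * P.sitesPerDir k) (y : Site P k) (z : Site P 0) (hz : Site.proj k k z = y) (ν : Fin P.d) :
    0 ≤ rel (Site.fibreSite 0 k y fun _ => ⟨0, pow_pos P.L_pos k⟩) z ν ∧ rel (Site.fibreSite 0 k y fun _ => ⟨0, pow_pos P.L_pos k⟩) z ν + 1 ≤ (P.L ^ k : ℕ) := by
  obtain ⟨r, hr⟩ := eq_fibreSite_proj h z
  rw [hz] at hr
  rw [hr, rel_corner_fibreSite hk y r]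
  have hrν : ((r ν : ℕ) : ℤ) < ((P.L ^ k : ℕ) : ℤ) := by exact_mod_cast (r ν).isLt
  dsimp only
  constructor
  · positivity
  · omega

/-- One step back from the block: `rel ȳ (z − e_μ) ν ∈ [−1, L^k − 1]` (`z ∈ B(y)`, `k ≥ 1` so no wrap). [cite: Balaban1987RG1, (0.3) p.252] -/
theorem rel_corner_unshift_of_proj_eq (hk : k ≤ P.m + P.K) (hk1 : 1 ≤ k) (h : P.sitesPerDir 0 = P.L ^ k * P.sitesPerDir k) (y : Site P k) (z : Site P 0)
    (hz : Site.proj k k z = y) (μ ν : Fin P.d) :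
    -1 ≤ rel (Site.fibreSite 0 k y fun _ => ⟨0, pow_pos P.L_pos k⟩) (z.unshift μ) ν
      ∧ rel (Site.fibreSite 0 k y fun _ => ⟨0, pow_pos P.L_pos k⟩) (z.unshift μ) ν + 1 ≤ (P.L ^ k : ℕ) := by
  obtain ⟨r, hr⟩ := eq_fibreSite_proj h z
  rw [hz] at hr
  have h6 := six_le_sitesPerDir hk hk1
  have hN : 2 * P.L ^ k ≤ P.sitesPerDir 0 := by
    rw [sitesPerDir_zero_eq_mul_pow hk]
    have := P.one_lt_sitesPerDir k
    nlinarith [pow_pos P.L_pos k]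
  -- `z − e_μ = ȳ + (r − e_μ)`
  have hzu : z.unshift μ = transl (Site.fibreSite 0 k y fun _ => ⟨0, pow_pos P.L_pos k⟩) ((fun ν => ((r ν : ℕ) : ℤ)) - e μ) := by
    rw [transl_sub_e, ← fibreSite_eq_transl y r, hr]
  have hN' : 2 * ((P.L ^ k : ℕ) : ℤ) ≤ (P.sitesPerDir 0 : ℤ) := by exact_mod_cast hN
  have h6' : (6 : ℤ) ≤ (P.sitesPerDir 0 : ℤ) := by exact_mod_cast h6
  have hrel : rel (Site.fibreSite 0 k y fun _ => ⟨0, pow_pos P.L_pos k⟩) (z.unshift μ) = (fun ν => ((r ν : ℕ) : ℤ)) - e μ := by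
    rw [hzu]
    refine rel_transl_of_mem _ _ fun κ => ?_
    have hrκ : ((r κ : ℕ) : ℤ) < ((P.L ^ k : ℕ) : ℤ) := by exact_mod_cast (r κ).isLt
    have hr0 : (0 : ℤ) ≤ ((r κ : ℕ) : ℤ) := by positivity
    simp only [Pi.sub_apply, B7Prop1Explicit.e_apply, Set.mem_Ioc]
    constructor
    · split_ifs <;> omega
    · split_ifs <;> omega
  rw [hrel]
  have hrν : ((r ν : ℕ) : ℤ) < ((P.L ^ k : ℕ) : ℤ) := by exact_mod_cast (r ν).isLt
  have hr0 : (0 : ℤ) ≤ ((r ν : ℕ) : ℤ) := by positivity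
  simp only [Pi.sub_apply, B7Prop1Explicit.e_apply]
  constructor
  · split_ifs <;> omega
  · split_ifs <;> omega

/-- ★ **THE GEOMETRY ROW OF THE CANONICAL DIRICHLET BOUND, FROM THE CORNER**: for `z ∈ B(y)` and the base `ȳ_y`, all four window ∕ no-wrap rows of ✓ `dirichlet_avg_axial_le_canonical` hold with
`R₀ := L^k` (`k ≥ 1`). [cite: Balaban1987RG1, (0.1)-(0.3) pp.251-252] -/
theorem hgeo_corner (hk : k ≤ P.m + P.K) (hk1 : 1 ≤ k) (h : P.sitesPerDir 0 = P.L ^ k * P.sitesPerDir k) (y : Site P k) (z : Site P 0) (hz : Site.proj k k z = y)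
    (μ ν : Fin P.d) :
    |rel (Site.fibreSite 0 k y fun _ => ⟨0, pow_pos P.L_pos k⟩) z ν| ≤ ((P.L ^ k : ℕ) : ℤ)
      ∧ |rel (Site.fibreSite 0 k y fun _ => ⟨0, pow_pos P.L_pos k⟩) ((torusT P 0 μ).symm z) ν| ≤ ((P.L ^ k : ℕ) : ℤ)
      ∧ (rel (Site.fibreSite 0 k y fun _ => ⟨0, pow_pos P.L_pos k⟩) z ν + 1) * 2 ≤ (P.sitesPerDir 0 : ℤ)
      ∧ (rel (Site.fibreSite 0 k y fun _ => ⟨0, pow_pos P.L_pos k⟩) ((torusT P 0 μ).symm z) ν + 1) * 2 ≤ (P.sitesPerDir 0 : ℤ) := by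
  have h1 := rel_corner_of_proj_eq hk h y z hz ν
  have h2 := rel_corner_unshift_of_proj_eq hk hk1 h y z hz μ ν
  rw [torusT_symm_apply]
  have hN : 2 * P.L ^ k ≤ P.sitesPerDir 0 := by
    rw [sitesPerDir_zero_eq_mul_pow hk]
    have := P.one_lt_sitesPerDir k
    nlinarith [pow_pos P.L_pos k]
  have hN' : (2 : ℤ) * (P.L ^ k : ℕ) ≤ (P.sitesPerDir 0 : ℤ) := by exact_mod_cast hN
  refine ⟨abs_le.mpr ⟨by linarith [h1.1], by linarith [h1.2]⟩, abs_le.mpr ⟨by linarith [h2.1], by linarith [h2.2]⟩, by linarith [h1.2], by linarith [h2.2]⟩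

end Geometry

/-! ## §2 Per block: the Gauss-comb local model is an axial model from the corner -/

section Block

variable {N : ℕ} [NeZero N] (hk : k ≤ P.m + P.K) (hk1 : 1 ≤ k) (h : P.sitesPerDir 0 = P.L ^ k * P.sitesPerDir k)
  {V : GaugeField P 0 (Matrix (Fin N) (Fin N) ℂ)ˣ} (hV : ∀ b, V b ∈ unitaryUnits (Matrix (Fin N) (Fin N) ℂ))

/-- `R((g·A)⁻¹)m = R(A⁻¹)(R(g⁻¹)m)` — the Gauss-comb model is the corner axial model with the datum transported to the corner frame. [folklore] -/
theorem R_mul_inv_eq {𝔸 : Type*} [Ring 𝔸] (g A : 𝔸ˣ) (m : 𝔸) : R (g * A)⁻¹ m = R A⁻¹ (R g⁻¹ m) := by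
  rw [mul_inv_rev, B9Eq39Adjoint.R_mul]

include hk hk1 h hV in
/-- ★★ **PER BLOCK, UNCONDITIONAL**: the supported covariant Dirichlet energy of the Gauss-comb local model `Ψ^{T_y} = R(g_y·axialT V ȳ_y ·)⁻¹ φ_y` over `B(y)` is at most the CANONICAL (Kg′) family
from the corner with datum `R(g_y⁻¹)φ_y` (✓ `dirichlet_avg_axial_le_canonical` at the one-point average, `R₀ := L^k`).
[cite: Balaban1985BackgroundPropagators, (3.3) p.390, (3.8) p.392; Balaban1985Averaging, (9) p.18, p.24; Balaban1985UV3, (27) p.263] -/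
theorem dirichlet_gaussComb_block_le_canonical (g : (Matrix (Fin N) (Fin N) ℂ)ˣ) (φy : Matrix (Fin N) (Fin N) ℂ) (y : Site P k)
    (s t : Fin P.d → List (Fin P.d)) (hsplit : ∀ μ, (List.finRange P.d).reverse = s μ ++ μ :: t μ) (hs : ∀ μ, μ ∉ s μ) (ht : ∀ μ, μ ∉ t μ) :
    ∑ z : Site P 0, (if Site.proj k k z = y then ∑ μ : Fin P.d,
        (‖covDstar (torusT P 0) (fun κ z => V ⟨z, κ⟩) μ (fun z => R (g * axialT V (Site.fibreSite 0 k y fun _ => ⟨0, pow_pos P.L_pos k⟩) z)⁻¹ φy) z‖ ^ 2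
          + ‖covD (torusT P 0) (fun κ z => V ⟨z, κ⟩) μ (fun z => R (g * axialT V (Site.fibreSite 0 k y fun _ => ⟨0, pow_pos P.L_pos k⟩) z)⁻¹ φy) z‖ ^ 2) else 0)
      ≤ (Fintype.card Unit : ℝ)⁻¹ * ∑ _η : Unit, (2 * ∑ μ : Fin P.d, ((((t μ).length * P.L ^ k : ℕ) : ℝ) * ∑ i ∈ Finset.range (t μ).length, (((2 * P.L ^ k + 1) ^ ((t μ).length - i) : ℕ) : ℝ)
          * ∑ q ∈ Fintype.piFinset (fun _ : Fin P.d => Finset.Icc (-((P.L ^ k : ℕ) : ℤ)) ((P.L ^ k : ℕ) : ℤ)),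
              (‖((hol (pull V (Site.fibreSite 0 k y fun _ => ⟨0, pow_pos P.L_pos k⟩)) q [((t μ).getD i μ, true), (μ, true), Letter.rev ((t μ).getD i μ, true), (μ, false)] :
                      (Matrix (Fin N) (Fin N) ℂ)ˣ) : Matrix (Fin N) (Fin N) ℂ)
                    * R (hol (pull V (Site.fibreSite 0 k y fun _ => ⟨0, pow_pos P.L_pos k⟩)) 0 (treeWord q))⁻¹ (R g⁻¹ φy)
                  - R (hol (pull V (Site.fibreSite 0 k y fun _ => ⟨0, pow_pos P.L_pos k⟩)) 0 (treeWord q))⁻¹ (R g⁻¹ φy)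
                    * ((hol (pull V (Site.fibreSite 0 k y fun _ => ⟨0, pow_pos P.L_pos k⟩)) q [((t μ).getD i μ, true), (μ, true), Letter.rev ((t μ).getD i μ, true), (μ, false)] :
                      (Matrix (Fin N) (Fin N) ℂ)ˣ) : Matrix (Fin N) (Fin N) ℂ)‖ ^ 2
              + ‖((hol (pull V (Site.fibreSite 0 k y fun _ => ⟨0, pow_pos P.L_pos k⟩)) q [((t μ).getD i μ, false), (μ, true), Letter.rev ((t μ).getD i μ, false), (μ, false)] :
                      (Matrix (Fin N) (Fin N) ℂ)ˣ) : Matrix (Fin N) (Fin N) ℂ)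
                    * R (hol (pull V (Site.fibreSite 0 k y fun _ => ⟨0, pow_pos P.L_pos k⟩)) 0 (treeWord q))⁻¹ (R g⁻¹ φy)
                  - R (hol (pull V (Site.fibreSite 0 k y fun _ => ⟨0, pow_pos P.L_pos k⟩)) 0 (treeWord q))⁻¹ (R g⁻¹ φy)
                    * ((hol (pull V (Site.fibreSite 0 k y fun _ => ⟨0, pow_pos P.L_pos k⟩)) q [((t μ).getD i μ, false), (μ, true), Letter.rev ((t μ).getD i μ, false), (μ, false)] :
                      (Matrix (Fin N) (Fin N) ℂ)ˣ) : Matrix (Fin N) (Fin N) ℂ)‖ ^ 2))) := by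
  classical
  have hV' : ∀ b : PBond P 0, ‖((V b : (Matrix (Fin N) (Fin N) ℂ)ˣ) : Matrix (Fin N) (Fin N) ℂ)‖ ≤ 1 ∧ ‖(((V b)⁻¹ : (Matrix (Fin N) (Fin N) ℂ)ˣ) : Matrix (Fin N) (Fin N) ℂ)‖ ≤ 1 :=
    fun b => bicontr_of_mem_unitary _ (mem_unitaryUnits.mp (hV b))
  have h1 := dirichlet_avg_axial_le_canonical V hV' (fun _ : Unit => Site.fibreSite 0 k y fun _ => ⟨0, pow_pos P.L_pos k⟩) (fun _ : Unit => R g⁻¹ φy)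
    (fun z => Site.proj k k z = y) (P.L ^ k) (fun z hz _ μ ν => hgeo_corner hk hk1 h y z hz μ ν) s t hsplit hs ht
  -- the one-point average IS the Gauss-comb model
  have hmodel : (fun z : Site P 0 => (Fintype.card Unit : ℝ)⁻¹ • ∑ _η : Unit, R (axialT V (Site.fibreSite 0 k y fun _ => ⟨0, pow_pos P.L_pos k⟩) z)⁻¹ (R g⁻¹ φy))
      = fun z => R (g * axialT V (Site.fibreSite 0 k y fun _ => ⟨0, pow_pos P.L_pos k⟩) z)⁻¹ φy := by
    funext z
    rw [Fintype.card_unit, Nat.cast_one, inv_one, one_smul, Fintype.sum_unique, R_mul_inv_eq]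
  rw [hmodel] at h1
  exact h1

end Block

/-! ## §3 The HXB′ door's interior Dirichlet energy is at most `N`× the canonical Gauss-comb family -/

section Door

variable {N : ℕ} [NeZero N] (hk : k ≤ P.m + P.K) (hk1 : 1 ≤ k) (h : P.sitesPerDir 0 = P.L ^ k * P.sitesPerDir k)
  {V : GaugeField P 0 (Matrix (Fin N) (Fin N) ℂ)ˣ} (hV : ∀ b, V b ∈ unitaryUnits (Matrix (Fin N) (Fin N) ℂ))

include hk hk1 h hV in
/-- ★★★ **hDirGauss, UNCONDITIONAL PART**: the HS Dirichlet energy of the Gauss-comb local models on the blocks' interior bonds (✓ `Prop7GaussCompositeSplit.two_mul_abs_gauss_pairing_allOffsets_le`'s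
letter VERBATIM) is at most `N`× the sum over blocks of the canonical (Kg′) families from the corners with data `R(g_y⁻¹)φ(y)` — so hDirGauss ⟸ ONE displayed hKg′-K(Gauss-fam) row, exactly as
hDir ⟸ hKg′-K(fam) (✓p680787). [cite: Balaban1985BackgroundPropagators, (3.3) p.390, (3.8) p.392; Balaban1985Averaging, (9) p.18, p.24; Balaban1985UV3, (27) p.263] -/
theorem dirGaussHS_int_le_canonical (g : Site P k → (Matrix (Fin N) (Fin N) ℂ)ˣ) (φ : Site P k → Matrix (Fin N) (Fin N) ℂ)
    (s t : Fin P.d → List (Fin P.d)) (hsplit : ∀ μ, (List.finRange P.d).reverse = s μ ++ μ :: t μ) (hs : ∀ μ, μ ∉ s μ) (ht : ∀ μ, μ ∉ t μ) :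
    ∑ y : Site P k, ∑ μ : Fin P.d, ∑ r ∈ univ.filter (fun r : Fin P.d → Fin (P.L ^ k) => (r μ : ℕ) + 1 < P.L ^ k),
        ∑ j : Fin N, ∑ l : Fin N, ‖(covD (torusT P 0) (fun κ z => V ⟨z, κ⟩) μ
          (fun z => R (g y * axialT V (Site.fibreSite 0 k y fun _ => ⟨0, pow_pos P.L_pos k⟩) z)⁻¹ (φ y)) (Site.fibreSite 0 k y r)) j l‖ ^ 2
      ≤ N * ∑ y : Site P k, (Fintype.card Unit : ℝ)⁻¹ * ∑ _η : Unit, (2 * ∑ μ : Fin P.d, ((((t μ).length * P.L ^ k : ℕ) : ℝ) * ∑ i ∈ Finset.range (t μ).length, (((2 * P.L ^ k + 1) ^ ((t μ).length - i) : ℕ) : ℝ)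
          * ∑ q ∈ Fintype.piFinset (fun _ : Fin P.d => Finset.Icc (-((P.L ^ k : ℕ) : ℤ)) ((P.L ^ k : ℕ) : ℤ)),
              (‖((hol (pull V (Site.fibreSite 0 k y fun _ => ⟨0, pow_pos P.L_pos k⟩)) q [((t μ).getD i μ, true), (μ, true), Letter.rev ((t μ).getD i μ, true), (μ, false)] :
                      (Matrix (Fin N) (Fin N) ℂ)ˣ) : Matrix (Fin N) (Fin N) ℂ)
                    * R (hol (pull V (Site.fibreSite 0 k y fun _ => ⟨0, pow_pos P.L_pos k⟩)) 0 (treeWord q))⁻¹ (R (g y)⁻¹ (φ y))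
                  - R (hol (pull V (Site.fibreSite 0 k y fun _ => ⟨0, pow_pos P.L_pos k⟩)) 0 (treeWord q))⁻¹ (R (g y)⁻¹ (φ y))
                    * ((hol (pull V (Site.fibreSite 0 k y fun _ => ⟨0, pow_pos P.L_pos k⟩)) q [((t μ).getD i μ, true), (μ, true), Letter.rev ((t μ).getD i μ, true), (μ, false)] :
                      (Matrix (Fin N) (Fin N) ℂ)ˣ) : Matrix (Fin N) (Fin N) ℂ)‖ ^ 2
              + ‖((hol (pull V (Site.fibreSite 0 k y fun _ => ⟨0, pow_pos P.L_pos k⟩)) q [((t μ).getD i μ, false), (μ, true), Letter.rev ((t μ).getD i μ, false), (μ, false)] :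
                      (Matrix (Fin N) (Fin N) ℂ)ˣ) : Matrix (Fin N) (Fin N) ℂ)
                    * R (hol (pull V (Site.fibreSite 0 k y fun _ => ⟨0, pow_pos P.L_pos k⟩)) 0 (treeWord q))⁻¹ (R (g y)⁻¹ (φ y))
                  - R (hol (pull V (Site.fibreSite 0 k y fun _ => ⟨0, pow_pos P.L_pos k⟩)) 0 (treeWord q))⁻¹ (R (g y)⁻¹ (φ y))
                    * ((hol (pull V (Site.fibreSite 0 k y fun _ => ⟨0, pow_pos P.L_pos k⟩)) q [((t μ).getD i μ, false), (μ, true), Letter.rev ((t μ).getD i μ, false), (μ, false)] :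
                      (Matrix (Fin N) (Fin N) ℂ)ˣ) : Matrix (Fin N) (Fin N) ℂ)‖ ^ 2))) := by
  classical
  rw [Finset.mul_sum]
  refine Finset.sum_le_sum fun y _ => ?_
  have hblock := dirichlet_gaussComb_block_le_canonical hk hk1 h hV (g y) (φ y) y s t hsplit hs ht
  -- abbreviate the model
  set Ψ : Site P 0 → Matrix (Fin N) (Fin N) ℂ := fun z => R (g y * axialT V (Site.fibreSite 0 k y fun _ => ⟨0, pow_pos P.L_pos k⟩) z)⁻¹ (φ y) with hΨ
  -- interior offsets ⊂ all offsets = the block; HS ≤ N·op²; `D*`-terms are nonnegative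
  calc ∑ μ : Fin P.d, ∑ r ∈ univ.filter (fun r : Fin P.d → Fin (P.L ^ k) => (r μ : ℕ) + 1 < P.L ^ k),
          ∑ j : Fin N, ∑ l : Fin N, ‖(covD (torusT P 0) (fun κ z => V ⟨z, κ⟩) μ Ψ (Site.fibreSite 0 k y r)) j l‖ ^ 2
      ≤ ∑ μ : Fin P.d, ∑ r : Fin P.d → Fin (P.L ^ k), (N : ℝ) * ‖covD (torusT P 0) (fun κ z => V ⟨z, κ⟩) μ Ψ (Site.fibreSite 0 k y r)‖ ^ 2 := by
        refine Finset.sum_le_sum fun μ _ => ?_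
        refine (Finset.sum_le_sum_of_subset_of_nonneg (Finset.filter_subset _ _) fun r _ _ => by positivity).trans ?_
        exact Finset.sum_le_sum fun r _ => sum_norm_sq_le_mul_opNorm_sq _
    _ = (N : ℝ) * ∑ r : Fin P.d → Fin (P.L ^ k), ∑ μ : Fin P.d, ‖covD (torusT P 0) (fun κ z => V ⟨z, κ⟩) μ Ψ (Site.fibreSite 0 k y r)‖ ^ 2 := by
        rw [Finset.sum_comm, Finset.mul_sum]
        refine Finset.sum_congr rfl fun r _ => ?_
        rw [Finset.mul_sum]
    _ ≤ (N : ℝ) * ∑ z : Site P 0, (if Site.proj k k z = y then ∑ μ : Fin P.d,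
          (‖covDstar (torusT P 0) (fun κ z => V ⟨z, κ⟩) μ Ψ z‖ ^ 2 + ‖covD (torusT P 0) (fun κ z => V ⟨z, κ⟩) μ Ψ z‖ ^ 2) else 0) := by
        refine mul_le_mul_of_nonneg_left ?_ (Nat.cast_nonneg _)
        rw [← Finset.sum_filter, sum_fibre_eq_sum_offsets h y]
        exact Finset.sum_le_sum fun r _ => Finset.sum_le_sum fun μ _ => le_add_of_nonneg_left (sq_nonneg _)
    _ ≤ _ := mul_le_mul_of_nonneg_left hblock (Nat.cast_nonneg _)

end Door

end Summit.QuantumFields.YangMills.Theorems.Prop7DirichletOfGaussComb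

end
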